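import Summits.QuantumFields.YangMills.Theorems.BalabanUVNodesN12RootedForestGeodesic
import Summits.QuantumFields.YangMills.Theorems.BalabanUVNodesN12RootedForestLamOfRecord
import HarnessLib

/-!
# BalabanUVNodes ∕ N12 — THE GEODESIC ROOTED FOREST AT PRINT's ROOTS: (F1), (F2) at `R(𝔅, k) = {ι_j c± : j ≤ k, c ∈ 𝔅 j}`, (TREE) and the TOWER-LENGTH letter `Lp`, for a bond datum `𝔅`
# and for the record's `lamBondsSeq (maxDomT M₁ Z) k` ([II] (2.3)) — the (F)-edition of dag-n12-w3's `…N12RootedForestGeodesic` §3 (the `hlen`∕`Lp` row of the (M)-chain and of the (J0′)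
# producer, now at print's datum)

[Balaban1984PropagatorsII] = «[II]», (2.3) p. 224; [Balaban1988Convergent] = «[III]», (2.2) p. 255, (2.13) pp. 256–257; [Balaban1985RegularSpaces] (1.14) p. 78, (1.19) p. 79; [Balaban1987RG1]
(0.1)–(0.3) pp. 251–252; [Balaban1985Variational] (4) p. 278, (16)–(18) p. 280.

Cell `pub-ymgap` (HUMAN RULINGS D-0062 ∕ D-0149), WIDTH SEAT `pub-ymgap-dag-n12-w6` g25 (node N12 = [B15]; key K1⁹ `stmt-QuantumFields-27364`, `--kind proof --supports … --as helper`;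
count-neutral).  THEOREMS ONLY (0 `def`, 0 `instance`, 0 `sorry`); BY NAME over dag-n12-w3's root-set-generic `…N12RootedForestGeodesic.exists_geodesicForest` ∕ `tdist_embIter_iterBlockOf_le` and
`…N12RootedForest.forest_F1`, the lane's `B15DeterminingSetsBEndpoints.exists_mem_lamBondsSeq_of_mem_genSet` ∕ `exists_mem_lamBondsSeq_maxDomT_of_mem_Bj` (every `Γ_j^{(j)}`-site is an
end-point of a PRINT bond — its in-block neighbour bond), dag-n12-w3's cover letter `N12FlatHndRecordLetters.hcov_Bj`.  Imports green (no `Record13*`).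

WHY.  At print's datum the roots are the end-point centres of PRINT bonds only (the inward connectors' deep ends are dropped); the geodesic breadth-first forest is root-set-generic, and the
tower-length letter survives unchanged because every member SITE of `Γ_j^{(j)}` is still a print root (end-point of its in-block neighbour bond) — so every fine site hangs within
`d·(L^j − 1)∕2` fine steps at its own scale, exactly as on the (b)-rooted forest.

CONTENTS (namespace `Summit.QuantumFields.YangMills.BalabanUVNodes.N12RootedForestGeodesicLam`): ★★ `exists_geodesicForest_bDetSet` (any bond datum with a member bond; length letter at every
site whose `j`-block centre is a print root), ★★ `exists_geodesicForest_lamBondsSeq` (any sequence `Ω` with (B) above the level: length letter keyed on `iterBlockOf j z ∈ genSet Ω k j`),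
★★★ `exists_geodesicForest_lamBondsSeq_maxDomT` (the record, hypothesis-free but for `1 ≤ k ≤ m + K`, `1 ≤ M₁`, cover divisibility: (F1) ∧ (F2) ∧ (TREE) ∧ length letter ∧ the `∃ j ≤ k`
cover form — w3's `exists_geodesicForest_Bj` binder-for-binder with `bondsOf (Bj M₁ Z k j) ↦ lamBondsSeq (maxDomT M₁ Z) k j` in (F2)∕(TREE)).  Decl map: `N12RootedForestGeodesic.exists_geodesicForest_{detSet,Bj}
↦ N12RootedForestGeodesicLam.exists_geodesicForest_{bDetSet,lamBondsSeq_maxDomT}`.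

HONEST FRAMING.  Lattice bookkeeping by name; nothing of Bałaban's estimates asserted or refuted; count-neutral helper; N12 NOT discharged; K0⁷∕K1⁹ NOT closed; counts of record unmoved;
one finite 𝕋⁴ programme at fixed ε — R4 closes only the conditional rung `BalabanLadder.UV`; no summit statement is proved here and NOT the Yang–Mills mass gap (Clay); nothing continuum ∕ ℝ⁴ ∕ OS.
-/

noncomputable section

namespace Summit.QuantumFields.YangMills.BalabanUVNodes.N12RootedForestGeodesicLam

open scoped BigOperators
open Literature.MathematicalPhysics.QuantumFieldTheory.Balaban1983to89
open T4Continuum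
open B15DeterminingSets B15DeterminingSetsB
open B14.Eq22Determines (IsBlockUnion)
open B14.Eq213DetSet (Bj maxDomT isBlockUnion_maxDomT)
open B14.Eq213MaximalDomains (side)
open B5Eq118OneStroke (iterBlockOf)
open B15DeterminingSetsBEndpoints (exists_mem_lamBondsSeq_of_mem_genSet exists_mem_lamBondsSeq_maxDomT_of_mem_Bj)
open Summit.QuantumFields.YangMills.BalabanUVNodes.N12RootedForest (forest_F1)
open Summit.QuantumFields.YangMills.BalabanUVNodes.N12RootedForestGeodesic (exists_geodesicForest tdist_embIter_iterBlockOf_le)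

variable {P : Params} {k : ℕ}

/-- ★★ **THE GEODESIC FOREST AT A BOND DATUM**: for `𝔅 : BDetSet` read up to `k ≤ m + K` with at least one member bond, a rooted forest with (F1), (F2), (TREE) at
`R(𝔅, k) = {ι_j c± : j ≤ k, c ∈ 𝔅 j}` AND the tower-length letter: every site hangs within `d·(L^j − 1)∕2` fine steps whenever its `j`-block centre is a root (an end-point of a member
bond of level `j ≤ k`). [cite: Balaban1985RegularSpaces, (1.14) p.78, (1.19) p.79; Balaban1988Convergent, (2.2) p.255; Balaban1987RG1, (0.1)–(0.3) pp.251–252; Balaban1984PropagatorsII, (2.3) p.224] -/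
theorem exists_geodesicForest_bDetSet (𝔅 : BDetSet P) (hk : k ≤ P.m + P.K) (hne : ∃ j, j ≤ k ∧ ∃ c, c ∈ 𝔅 j) :
    ∃ path : Site P 0 → List (LStep P 0),
      (∀ x, ∀ s ∈ path x, ∃ x' x'' : Site P 0, path x'' = path x' ++ [s] ∧
        (s.fwd = true → s.bond.src = x' ∧ s.bond.tgt = x'') ∧ (s.fwd = false → s.bond.src = x'' ∧ s.bond.tgt = x')) ∧
      (∀ j, j ≤ k → ∀ c ∈ 𝔅 j, path (embIter j c.src) = [] ∧ path (embIter j c.tgt) = []) ∧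
      (∀ x : Site P 0, x ∉ {z : Site P 0 | ∃ j, j ≤ k ∧ ∃ c ∈ 𝔅 j, (z = embIter j c.src ∨ z = embIter j c.tgt)} →
        ∃ (x' : Site P 0) (s : LStep P 0), path x = path x' ++ [s] ∧
          (s.fwd = true → s.bond.src = x' ∧ s.bond.tgt = x) ∧ (s.fwd = false → s.bond.src = x ∧ s.bond.tgt = x')) ∧
      (∀ (z : Site P 0) (j : ℕ), j ≤ k → (∃ c ∈ 𝔅 j, c.src = iterBlockOf j z ∨ c.tgt = iterBlockOf j z) → (path z).length ≤ P.d * ((P.L ^ j - 1) / 2)) := by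
  obtain ⟨j₀, hj₀, c₀, hc₀⟩ := hne
  obtain ⟨path, hroot, htree, hgeo⟩ := exists_geodesicForest
    {z : Site P 0 | ∃ j, j ≤ k ∧ ∃ c ∈ 𝔅 j, (z = embIter j c.src ∨ z = embIter j c.tgt)} ⟨embIter j₀ c₀.src, j₀, hj₀, c₀, hc₀, Or.inl rfl⟩
  refine ⟨path, forest_F1 hroot htree, fun j hj c hc => ⟨hroot _ ⟨j, hj, c, hc, Or.inl rfl⟩, hroot _ ⟨j, hj, c, hc, Or.inr rfl⟩⟩, htree,
    fun z j hj hz => ?_⟩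
  obtain ⟨c, hc, hcz⟩ := hz
  have hmem : embIter j (iterBlockOf j z) ∈ {z : Site P 0 | ∃ j, j ≤ k ∧ ∃ c ∈ 𝔅 j, (z = embIter j c.src ∨ z = embIter j c.tgt)} := by
    rcases hcz with h | h
    · exact ⟨j, hj, c, hc, Or.inl (by rw [h])⟩
    · exact ⟨j, hj, c, hc, Or.inr (by rw [h])⟩
  exact (hgeo z _ hmem).trans (tdist_embIter_iterBlockOf_le (hj.trans hk) z)

/-- ★★ **THE GEODESIC FOREST AT PRINT's DATUM OF A SEQUENCE `Ω`** (`k ≤ m + K`; `Ω_{j+1}` a union of `(j+1)`-blocks for `1 ≤ j < k`; one `Γ`-site given): (F1) ∧ (F2) on `lamBondsSeq Ω k` ∧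
(TREE) ∧ the tower-length letter keyed on SITE membership `iterBlockOf j z ∈ genSet Ω k j` (`1 ≤ j ≤ k`, or `j = 0`) — every `Γ_j^{(j)}`-site is an end-point of a print bond
(`exists_mem_lamBondsSeq_of_mem_genSet`). [cite: Balaban1984PropagatorsII, (2.3) p.224; Balaban1988Convergent, (2.2) p.255, (2.13) pp.256–257; Balaban1985RegularSpaces, (1.19) p.79] -/
theorem exists_geodesicForest_lamBondsSeq {Ω : ℕ → Set (Site P 0)} (hk : k ≤ P.m + P.K)
    (hBU : ∀ j, 1 ≤ j → j ≤ k → IsBlockUnion j (Ω j)) {j₀ : ℕ} (hj₀ : j₀ ≤ k) {y₀ : Site P j₀} (hy₀ : y₀ ∈ genSet Ω k j₀) :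
    ∃ path : Site P 0 → List (LStep P 0),
      (∀ x, ∀ s ∈ path x, ∃ x' x'' : Site P 0, path x'' = path x' ++ [s] ∧
        (s.fwd = true → s.bond.src = x' ∧ s.bond.tgt = x'') ∧ (s.fwd = false → s.bond.src = x'' ∧ s.bond.tgt = x')) ∧
      (∀ j, j ≤ k → ∀ c ∈ lamBondsSeq Ω k j, path (embIter j c.src) = [] ∧ path (embIter j c.tgt) = []) ∧
      (∀ x : Site P 0, x ∉ {z : Site P 0 | ∃ j, j ≤ k ∧ ∃ c ∈ lamBondsSeq Ω k j, (z = embIter j c.src ∨ z = embIter j c.tgt)} →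
        ∃ (x' : Site P 0) (s : LStep P 0), path x = path x' ++ [s] ∧
          (s.fwd = true → s.bond.src = x' ∧ s.bond.tgt = x) ∧ (s.fwd = false → s.bond.src = x ∧ s.bond.tgt = x')) ∧
      (∀ (z : Site P 0) (j : ℕ), j ≤ k → iterBlockOf j z ∈ genSet Ω k j → (path z).length ≤ P.d * ((P.L ^ j - 1) / 2)) := by
  have hBU' : ∀ {j : ℕ}, j ≤ k → j < k → IsBlockUnion (j + 1) (Ω (j + 1)) := fun _ hjk => hBU _ (by omega) (by omega)
  obtain ⟨c₀, hc₀, -⟩ := exists_mem_lamBondsSeq_of_mem_genSet Ω hk (hBU' hj₀) hy₀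
  obtain ⟨path, h1, h2, h3, h4⟩ := exists_geodesicForest_bDetSet (lamBondsSeq Ω k) hk ⟨j₀, hj₀, c₀, hc₀⟩
  refine ⟨path, h1, h2, h3, fun z j hj hz => h4 z j hj ?_⟩
  obtain ⟨c, hc, hcz⟩ := exists_mem_lamBondsSeq_of_mem_genSet Ω hk (hBU' hj) hz
  exact ⟨c, hc, hcz⟩

/-- ★★★ **THE GEODESIC FOREST AT THE RECORD's PRINT DATUM `lamBondsSeq (maxDomT M₁ Z) k`, EVERY `Z`** — dag-n12-w3's `exists_geodesicForest_Bj` binder-for-binder (`k ≤ m + K`, `1 ≤ k`,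
`1 ≤ M₁`, cover divisibility) with the roots ∕ (F2) ∕ (TREE) on PRINT's bonds: (F1) ∧ (F2) ∧ (TREE) ∧ the tower-length letter `iterBlockOf j z ∈ 𝐁_k(Z) j → (path z).length ≤ d·(L^j − 1)∕2`
∧ the cover form `∀ z, ∃ j ≤ k, (path z).length ≤ d·(L^j − 1)∕2` (`hcov_Bj`).  This is the `Lp` row of the (M)-chain ∕ the (J0′) producer at print's datum.
[cite: Balaban1984PropagatorsII, (2.3) p.224; Balaban1988Convergent, (2.2) p.255, (2.13) pp.256–257; Balaban1985RegularSpaces, (1.19) p.79; Balaban1987RG1, (0.1)–(0.3) pp.251–252] -/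
theorem exists_geodesicForest_lamBondsSeq_maxDomT {M₁ : ℕ} {Z : Set (Site P 0)} (hk : k ≤ P.m + P.K) (hk1 : 1 ≤ k) (hM : 1 ≤ M₁)
    (hdiv : side P.L M₁ k ∣ P.sitesPerDir 0) :
    ∃ path : Site P 0 → List (LStep P 0),
      (∀ x, ∀ s ∈ path x, ∃ x' x'' : Site P 0, path x'' = path x' ++ [s] ∧
        (s.fwd = true → s.bond.src = x' ∧ s.bond.tgt = x'') ∧ (s.fwd = false → s.bond.src = x'' ∧ s.bond.tgt = x')) ∧
      (∀ j, j ≤ k → ∀ c ∈ lamBondsSeq (maxDomT M₁ Z) k j, path (embIter j c.src) = [] ∧ path (embIter j c.tgt) = []) ∧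
      (∀ x : Site P 0, x ∉ {z : Site P 0 | ∃ j, j ≤ k ∧ ∃ c ∈ lamBondsSeq (maxDomT M₁ Z) k j, (z = embIter j c.src ∨ z = embIter j c.tgt)} →
        ∃ (x' : Site P 0) (s : LStep P 0), path x = path x' ++ [s] ∧
          (s.fwd = true → s.bond.src = x' ∧ s.bond.tgt = x) ∧ (s.fwd = false → s.bond.src = x ∧ s.bond.tgt = x')) ∧
      (∀ (z : Site P 0) (j : ℕ), j ≤ k → iterBlockOf j z ∈ (Bj M₁ Z k : DetSet P) j → (path z).length ≤ P.d * ((P.L ^ j - 1) / 2)) ∧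
      (∀ z : Site P 0, ∃ j, j ≤ k ∧ (path z).length ≤ P.d * ((P.L ^ j - 1) / 2)) := by
  obtain ⟨j, hj, hy⟩ := N12FlatHndRecordLetters.hcov_Bj hM hk1 hk hdiv (default : Site P 0)
  obtain ⟨path, h1, h2, h3, h4⟩ := exists_geodesicForest_lamBondsSeq (Ω := maxDomT M₁ Z) hk
    (fun j hj1 hjk => isBlockUnion_maxDomT hM hdiv hj1 hjk (hjk.trans hk)) hj hy
  refine ⟨path, h1, h2, h3, h4, fun z => ?_⟩
  obtain ⟨j', hj', hz⟩ := N12FlatHndRecordLetters.hcov_Bj hM hk1 hk hdiv z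
  exact ⟨j', hj', h4 z j' hj' hz⟩

end Summit.QuantumFields.YangMills.BalabanUVNodes.N12RootedForestGeodesicLam

end
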